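import Mathlib.MeasureTheory.Function.JacobianOneDim
import Mathlib.Analysis.SpecialFunctions.Integrals.Basic
import Mathlib.Analysis.SpecialFunctions.Sqrt
import HarnessLib

/-!
# The law of the outgoing (cosine, speed ratio) of ONE true collision step against the Lorentz step, I:
# the Jacobian comparison on the bulk and the exact Lorentz law `4ρ² dρ`
# (helper `t12_stepCos_lorentz_eq` of the line `birth`, crux `TwoClocks.EquilibriumFastWindowLD`,
# stmt-AtomisticToContinuum-14440; §6 of the registered analytic sub-goal `t12_logLinearPreimage_and_dipoleModulus`
# via slices, step (3): the one-step moment comparison of the Markov chain (cosine, speed ratio))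

The slice geometry (`t12_trueSlice_circle`): a particle of speed `S` in direction `n` hits a Maxwellian partner at
impact direction `ω`, `x = ⟪n, ω⟫ ∈ [-1, 1]`, partner projection `τ = ⟪w, ω⟫ ∼ γ = N(0, 1)`, flux `(S x - τ)₊`;
the own outgoing velocity `v' = v - (S x - τ) ω` has speed `r = √(S² - (S x)² + τ²)` and cosine
`ρ = ⟪v', n⟫/r = (S - (S x - τ) x)/r` about `n`, both azimuth-free. In the reduced variable `t = τ/S`
(`…StepMomentsB.stepCos_scale`): `r/S = √m`, `m := 1 - x² + t²`, `ρ = (1 - (x - t) x)/√m`, flux `S (x - t)₊`.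
The `k`-fold far-field scheme of plan §6 needs, per step and uniformly in the angular degree `ℓ`, the
flux-normalised (`ν ≥ πS`) numbers `(4/S) ∫ γ(dτ) ∫_{-1}^{1} (S x - τ)₊ (weight) |P_ℓ(ρ)| dx` against their
Lorentz values `μ_ℓ = 4 ∫₀¹ z² |P_ℓ(z)| dz` (`…T12Legendre`): a comparison of the LAW of `ρ` under the weight
`4 (x - t)₊ √m dx` (speed-ratio weight `r/S`) with the Lorentz law `4ρ² dρ` (`t = 0`: `ρ = √m = √(1 - x²)`).

**The Jacobian computation.** Along the slice `dρ/dx = -(x - t)(m - t x)/(m √m)` (`hasDerivAt_stepCos`), so the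
pushforward density of `4 (x - t)₊ √m dx` under `x ↦ ρ` is, branch by branch,

  `J_t(ρ) = 4 m² / |m - t x|`,  `J_0(ρ) = 4 (1 - x²) = 4ρ²`,

and `4 m³ - 4 ρ² m (m - t x) = 4 t (-(x - t) m² + t m + (x - t)² t² x)` exactly. Findings: (i) for `t < 0` the
cosine runs through `[-1, 1]` and `J_t(0) = 2|t| (x - t) ≈ 2|t| > 0 = J_0(0)` — the ratio `J_t/J_0` is UNBOUNDED
at `ρ → 0`, so no multiplicative comparison `J_t ≤ (1 + C|t|) J_0` can hold and an additive `O(|t|) sup F` term is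
forced; (ii) for `t > 0` the map `x ↦ ρ` folds back (`dρ/dx = 0` at `m = t x`, `m ≈ t`) with an inverse-square-root
singularity of `J_t`; (iii) on the bulk `m > 4|t|` (`|t| ≤ 1/4`) the map is strictly decreasing with values in
`[0, 1]` and `J_t ≤ 4ρ² + 8|t|` (`stepCos_key`, a polynomial inequality), while the grazing remainder `m ≤ 4|t|`
carries mass `O(|t|^{3/2})`. Whence the additive domination (`…StepMomentsB`): for every measurable `0 ≤ F ≤ 1`,

  `4 ∫_{-1}^{1} (x - t)₊ √m F(ρ) dx ≤ 4 ∫₀¹ z² F(z) dz + 32 |t| (1 + |t|)²`,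

uniform in `F` — with `F = |P_ℓ|` the right side is `μ_ℓ + O(|τ|/S)` with NO dependence on `ℓ` (the planned
head/tail split with a Markov constant `ℓ²` is unnecessary). This file: the algebra of the slice, the bulk
comparison by Mathlib's change of variables for antitone maps
(`integral_image_eq_integral_deriv_smul_of_antitoneOn`, valid for every measurable `F`), and the registered
**`t12_stepCos_lorentz_eq`** — the Lorentz slice is EXACTLY the law `4ρ² dρ`:
`4 ∫_{-1}^{1} x₊ √(1 - x²) F((1 - x·x)/√(1 - x²)) dx = 4 ∫₀¹ z² F(z) dz` for every `F` (with `F = |P_ℓ|`: the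
Lorentz one-step number is `μ_ℓ`).

[folklore] (Carleman's parametrisation of the hard-sphere gain term, Carleman 1933; Cercignani–Illner–Pulvirenti
1994 §7.2; Grad 1963 §4 for the far-field (Lorentz) limit; the slice route of the line `birth`.)
-/

noncomputable section

open MeasureTheory Real Set Filter
open scoped ENNReal BigOperators
namespace Summit.AtomisticToContinuum.HydrodynamicLimit.Theorems.ClampedCorrectorBirth

/-! ### Algebra of one slice: `m = 1 - x² + t²`, `ρ = (1 - (x - t) x)/√m` -/

/-- `m - (1 - (x-t)x)² = (x-t)²(1 - x²) ≥ 0`: the outgoing cosine is at most one (`|x| ≤ 1`). [folklore] -/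
theorem stepCos_num_sq_le {x : ℝ} (hx : |x| ≤ 1) (t : ℝ) :
    (1 - (x - t) * x) ^ 2 ≤ 1 - x ^ 2 + t ^ 2 := by
  have h1 : x ^ 2 ≤ 1 := by
    have := abs_le.1 hx
    nlinarith
  nlinarith [mul_nonneg (sq_nonneg (x - t)) (sub_nonneg.2 h1)]

/-- `|ρ| ≤ 1`: `|(1 - (x-t)x)/√(1 - x² + t²)| ≤ 1` for `|x| ≤ 1` (all `t`; junk value `0` when the
radicand vanishes). [folklore] -/
theorem abs_stepCos_le_one {x : ℝ} (hx : |x| ≤ 1) (t : ℝ) :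
    |(1 - (x - t) * x) / √(1 - x ^ 2 + t ^ 2)| ≤ 1 := by
  rw [abs_div, abs_of_nonneg (sqrt_nonneg _)]
  exact div_le_one_of_le₀ (abs_le_sqrt (stepCos_num_sq_le hx t)) (sqrt_nonneg _)

/-- The derivative of the outgoing cosine along the slice:
`d/dx [(1 - (x-t)x)/√m] = -(x - t)(m - t x)/(m √m)`, `m = 1 - x² + t² > 0`. [folklore] -/
theorem hasDerivAt_stepCos (t : ℝ) {x : ℝ} (hm : 0 < 1 - x ^ 2 + t ^ 2) :
    HasDerivAt (fun y : ℝ => (1 - (y - t) * y) / √(1 - y ^ 2 + t ^ 2))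
      (-((x - t) * (1 - x ^ 2 + t ^ 2 - t * x)) / ((1 - x ^ 2 + t ^ 2) * √(1 - x ^ 2 + t ^ 2))) x := by
  set s : ℝ := √(1 - x ^ 2 + t ^ 2) with hs
  have hs0 : 0 < s := sqrt_pos.2 hm
  have hs2 : s ^ 2 = 1 - x ^ 2 + t ^ 2 := sq_sqrt hm.le
  have hnum : HasDerivAt (fun y : ℝ => 1 - (y - t) * y) (0 - (1 * x + (x - t) * 1)) x :=
    (hasDerivAt_const x (1:ℝ)).sub (((hasDerivAt_id x).sub_const t).mul (hasDerivAt_id x))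
  have hrad : HasDerivAt (fun y : ℝ => 1 - y ^ 2 + t ^ 2) (0 - ↑(2:ℕ) * x ^ (2 - 1) * 1 + 0) x :=
    ((hasDerivAt_const x (1:ℝ)).sub ((hasDerivAt_id x).pow 2)).add (hasDerivAt_const x _)
  have hden : HasDerivAt (fun y : ℝ => √(1 - y ^ 2 + t ^ 2))
      ((0 - ↑(2:ℕ) * x ^ (2 - 1) * 1 + 0) / (2 * s)) x := hrad.sqrt hm.ne'
  have h := hnum.div hden hs0.ne'
  refine h.congr_deriv ?_
  -- the only use of `s² = m`: `(t - 2x) s² + (1 - (x-t)x) x = -(x-t)(s² - t x)`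
  have h0 : (t - 2 * x) * s ^ 2 + (1 - (x - t) * x) * x = -((x - t) * (s ^ 2 - t * x)) := by
    have : (t - 2 * x) * s ^ 2 + (1 - (x - t) * x) * x + (x - t) * (s ^ 2 - t * x) =
        x * (1 - x ^ 2 + t ^ 2 - s ^ 2) := by ring
    rw [← hs2, sub_self, mul_zero] at this
    linarith
  rw [← hs, ← hs2, ← h0]
  push_cast
  field_simp
  ring

/-- **The Jacobian comparison `J_t ≤ 4ρ² + 8|t|` on the bulk**, in polynomial form: for `|t| ≤ 1/4`,
`t < x ≤ 1` and `m = 1 - x² + t² > 4|t|`,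
`4 m³ ≤ (m - t x) (4 (1 - (x-t)x)² + 8 |t| m)`
(the pushforward density of the weight `4 (x-t) √m dx` under `x ↦ ρ` is `J_t = 4m²/(m - t x)`, the
Lorentz one is `4ρ²`, and `4m³ - 4ρ² m (m - t x) = 4t(-(x-t) m² + t m + (x-t)² t² x)`). [folklore] -/
theorem stepCos_key {t x : ℝ} (ht : |t| ≤ 1 / 4) (htx : t < x) (hx1 : x ≤ 1)
    (hm4 : 4 * |t| < 1 - x ^ 2 + t ^ 2) :
    4 * (1 - x ^ 2 + t ^ 2) ^ 3 ≤
      (1 - x ^ 2 + t ^ 2 - t * x) * (4 * (1 - (x - t) * x) ^ 2 + 8 * |t| * (1 - x ^ 2 + t ^ 2)) := by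
  have hid : (1 - x ^ 2 + t ^ 2 - t * x) * (4 * (1 - (x - t) * x) ^ 2 + 8 * |t| * (1 - x ^ 2 + t ^ 2)) -
      4 * (1 - x ^ 2 + t ^ 2) ^ 3 = 4 * (2 * |t| * (1 - x ^ 2 + t ^ 2) * (1 - x ^ 2 + t ^ 2 - t * x) -
        t * (-(x - t) * (1 - x ^ 2 + t ^ 2) ^ 2 + t * (1 - x ^ 2 + t ^ 2) + (x - t) ^ 2 * t ^ 2 * x)) := by
    ring
  rw [← sub_nonneg, hid]
  clear hid
  refine mul_nonneg (by norm_num) ?_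
  have habs := abs_nonneg t
  set m : ℝ := 1 - x ^ 2 + t ^ 2 with hm
  have hm0 : 0 < m := by linarith
  rcases le_or_gt 0 t with ht0 | ht0
  · rw [abs_of_nonneg ht0] at ht hm4 ⊢
    have hx0 : 0 ≤ x := ht0.trans htx.le
    have hu1 : x - t ≤ 1 := by linarith
    have hu0 : 0 ≤ x - t := by linarith
    -- the bracket `B := 2 m (m - t x) + (x - t) m² - t m - (x-t)² t² x ≥ 0`, total `= t * B`
    have h1 : t * m ≤ m ^ 2 / 4 := by nlinarith [mul_le_mul_of_nonneg_right hm4.le hm0.le]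
    have h2 : t * m * x ≤ m ^ 2 / 4 := by nlinarith [mul_le_mul_of_nonneg_left hx1 (by positivity : 0 ≤ t * m)]
    have h3 : (x - t) ^ 2 * t ^ 2 * x ≤ m ^ 2 / 16 := by
      have h31 : (x - t) ^ 2 * x ≤ 1 := by nlinarith [mul_le_one₀ hu1 hu0 hu1, mul_nonneg hu0 hu0]
      have h32 : t ^ 2 ≤ m ^ 2 / 16 := by nlinarith [mul_le_mul hm4.le hm4.le (by positivity) hm0.le]
      nlinarith [mul_le_mul h31 h32 (sq_nonneg t) zero_le_one]
    have h4 : 0 ≤ (x - t) * m ^ 2 := by positivity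
    have hB : 0 ≤ 2 * m * (m - t * x) + (x - t) * m ^ 2 - t * m - (x - t) ^ 2 * t ^ 2 * x := by
      nlinarith [sq_nonneg m]
    have : 2 * t * m * (m - t * x) - t * (-(x - t) * m ^ 2 + t * m + (x - t) ^ 2 * t ^ 2 * x) =
        t * (2 * m * (m - t * x) + (x - t) * m ^ 2 - t * m - (x - t) ^ 2 * t ^ 2 * x) := by ring
    rw [this]
    exact mul_nonneg ht0 hB
  · rw [abs_of_neg ht0] at ht hm4 ⊢
    have hu1 : x - t ≤ 5 / 4 := by linarith
    have hu0 : 0 ≤ x - t := by linarith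
    have hxt : t ≤ x := htx.le
    -- `σ = -t`; bracket `B := 2 m (m - t x) - (x - t) m² + t m + (x-t)² t² x ≥ 0`, total `= (-t) * B`
    have h1 : (x - t) * m ^ 2 ≤ 5 / 4 * m ^ 2 := mul_le_mul_of_nonneg_right hu1 (sq_nonneg m)
    have h2 : -(m ^ 2 / 8) ≤ 2 * m * (-t * x) := by
      have h21 : t ^ 2 ≤ m / 16 := by nlinarith [mul_le_mul ht hm4.le (by linarith) (by norm_num)]
      have h22 : -t * x ≥ -(t ^ 2) := by nlinarith [mul_le_mul_of_nonneg_left hxt (by linarith : 0 ≤ -t)]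
      nlinarith [mul_le_mul_of_nonneg_left h22 hm0.le, mul_le_mul_of_nonneg_right h21 hm0.le]
    have h3 : -(m ^ 2 / 4) ≤ t * m := by nlinarith [mul_le_mul_of_nonneg_right hm4.le hm0.le]
    have h4 : -(25 / 1024 * m ^ 2) ≤ (x - t) ^ 2 * t ^ 2 * x := by
      have h41 : (x - t) ^ 2 ≤ 25 / 16 := by nlinarith [mul_le_mul hu1 hu1 hu0 (by norm_num)]
      have h42 : (-t) ^ 3 ≤ m ^ 2 / 64 := by
        have h421 : (-t) ^ 2 ≤ (m / 4) ^ 2 := by nlinarith [mul_le_mul hm4.le hm4.le (by linarith) hm0.le]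
        nlinarith [mul_le_mul ht h421 (sq_nonneg _) (by norm_num)]
      have h43 : (x - t) ^ 2 * t ^ 2 * x ≥ -((x - t) ^ 2 * (-t) ^ 3) := by
        have : t ^ 2 * x ≥ t ^ 2 * t := mul_le_mul_of_nonneg_left hxt (sq_nonneg t)
        nlinarith [mul_le_mul_of_nonneg_left this (sq_nonneg (x - t))]
      nlinarith [mul_le_mul_of_nonneg_left h42 (sq_nonneg (x - t))]
    have hB : 0 ≤ 2 * m * (m - t * x) - (x - t) * m ^ 2 + t * m + (x - t) ^ 2 * t ^ 2 * x := by
      nlinarith [sq_nonneg m]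
    have : 2 * -t * m * (m - t * x) - t * (-(x - t) * m ^ 2 + t * m + (x - t) ^ 2 * t ^ 2 * x) =
        (-t) * (2 * m * (m - t * x) - (x - t) * m ^ 2 + t * m + (x - t) ^ 2 * t ^ 2 * x) := by ring
    rw [this]
    exact mul_nonneg (by linarith) hB

/-- **Pointwise domination on the bulk**: for `|t| ≤ 1/4`, `t < x ≤ 1`, `m > 4|t|` and `F ≥ 0`,
`4 (x-t)₊ √m F(ρ) ≤ (-ρ') (4ρ² + 8|t|) F(ρ)` — the weight of the true slice is dominated by the pull-back
of the Lorentz density `4ρ²` plus the flat excess `8|t|`. [folklore] -/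
theorem stepCos_dom {F : ℝ → ℝ} (hF0 : ∀ z, 0 ≤ F z) {t x : ℝ} (ht : |t| ≤ 1 / 4) (htx : t < x)
    (hx1 : x ≤ 1) (hm4 : 4 * |t| < 1 - x ^ 2 + t ^ 2) :
    4 * (max (x - t) 0 * (√(1 - x ^ 2 + t ^ 2) * F ((1 - (x - t) * x) / √(1 - x ^ 2 + t ^ 2)))) ≤
      -(-((x - t) * (1 - x ^ 2 + t ^ 2 - t * x)) / ((1 - x ^ 2 + t ^ 2) * √(1 - x ^ 2 + t ^ 2))) •
        ((4 * ((1 - (x - t) * x) / √(1 - x ^ 2 + t ^ 2)) ^ 2 + 8 * |t|) *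
          F ((1 - (x - t) * x) / √(1 - x ^ 2 + t ^ 2))) := by
  have key := stepCos_key ht htx hx1 hm4
  have hm0 : 0 < 1 - x ^ 2 + t ^ 2 := lt_of_le_of_lt (by positivity) hm4
  set s : ℝ := √(1 - x ^ 2 + t ^ 2) with hs
  have hs0 : 0 < s := sqrt_pos.2 hm0
  have hs2 : s ^ 2 = 1 - x ^ 2 + t ^ 2 := sq_sqrt hm0.le
  rw [← hs2] at key hm4
  rw [smul_eq_mul, max_eq_left (sub_nonneg.2 htx.le), ← hs2, ← sub_nonneg]
  have hF := hF0 ((1 - (x - t) * x) / s)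
  have e : -(-((x - t) * (s ^ 2 - t * x)) / (s ^ 2 * s)) *
        ((4 * ((1 - (x - t) * x) / s) ^ 2 + 8 * |t|) * F ((1 - (x - t) * x) / s)) -
      4 * ((x - t) * (s * F ((1 - (x - t) * x) / s))) =
      (x - t) * F ((1 - (x - t) * x) / s) *
        ((s ^ 2 - t * x) * (4 * (1 - (x - t) * x) ^ 2 + 8 * |t| * s ^ 2) - 4 * (s ^ 2) ^ 3) / s ^ 5 := by
    field_simp
  rw [e]
  exact div_nonneg (mul_nonneg (mul_nonneg (sub_nonneg.2 htx.le) hF) (sub_nonneg.2 key)) (by positivity)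

/-! ### The bulk: change of variables `x ↦ ρ` -/

/-- **The bulk of one slice is dominated by the Lorentz law plus `8|t|`**: for measurable `F` with
`0 ≤ F`, `F ≤ 1` on `[-1, 1]`, and `|t| ≤ 1/4`, with `x₁ = √(1 + t² - 4|t|)` (so that `m ≥ 4|t|` on `(t, x₁)`),
`∫_{(t, x₁)} 4 (x-t)₊ √m F(ρ) dx ≤ 4 ∫₀¹ z² F(z) dz + 8|t|`
(the cosine `ρ` is strictly decreasing on `(t, x₁)` with values in `[0, 1]`; Mathlib's change of variables
`integral_image_eq_integral_deriv_smul_of_antitoneOn`, valid for every measurable `F`). [folklore] -/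
theorem stepCos_bulk_le {F : ℝ → ℝ} (hF : Measurable F) (hF0 : ∀ z, 0 ≤ F z)
    (hF1 : ∀ z, |z| ≤ 1 → F z ≤ 1) {t : ℝ} (ht : |t| ≤ 1 / 4) :
    ∫ x in Ioo t √(1 + t ^ 2 - 4 * |t|),
        4 * (max (x - t) 0 * (√(1 - x ^ 2 + t ^ 2) * F ((1 - (x - t) * x) / √(1 - x ^ 2 + t ^ 2)))) ≤
      (4 * ∫ z in (0:ℝ)..1, z ^ 2 * F z) + 8 * |t| := by
  set x₁ : ℝ := √(1 + t ^ 2 - 4 * |t|) with hx₁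
  have habs := abs_nonneg t
  have htsq : t ^ 2 = |t| ^ 2 := (sq_abs t).symm
  have hx₁sq : x₁ ^ 2 = 1 + t ^ 2 - 4 * |t| := sq_sqrt (by nlinarith)
  have hx₁0 : 0 ≤ x₁ := sqrt_nonneg _
  have hx₁1 : x₁ ≤ 1 := sqrt_le_one.2 (by nlinarith)
  have htx₁ : |t| ≤ x₁ := abs_le_sqrt (by rw [← sq_abs]; nlinarith)
  -- the region
  have hreg : ∀ x ∈ Ioo t x₁, 4 * |t| < 1 - x ^ 2 + t ^ 2 ∧ x ≤ 1 := by
    intro x hx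
    refine ⟨?_, hx.2.le.trans hx₁1⟩
    rcases le_or_gt 0 x with h0 | h0
    · have : x ^ 2 < x₁ ^ 2 := by nlinarith [hx.2]
      nlinarith
    · have h1 : -|t| ≤ t := neg_abs_le t
      have : x ^ 2 < t ^ 2 := by nlinarith [hx.1]
      nlinarith
  -- the map `ρ`, its derivative, monotonicity
  have hder : ∀ x ∈ Ioo t x₁, HasDerivAt (fun y : ℝ => (1 - (y - t) * y) / √(1 - y ^ 2 + t ^ 2))
      (-((x - t) * (1 - x ^ 2 + t ^ 2 - t * x)) / ((1 - x ^ 2 + t ^ 2) * √(1 - x ^ 2 + t ^ 2))) x :=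
    fun x hx => hasDerivAt_stepCos t (lt_of_le_of_lt (by positivity) (hreg x hx).1)
  have hρ'le : ∀ x ∈ Ioo t x₁,
      -((x - t) * (1 - x ^ 2 + t ^ 2 - t * x)) / ((1 - x ^ 2 + t ^ 2) * √(1 - x ^ 2 + t ^ 2)) ≤ 0 := by
    intro x hx
    have hm4 := (hreg x hx).1
    have hm0 : 0 < 1 - x ^ 2 + t ^ 2 := lt_of_le_of_lt (by positivity) hm4
    have h1 : 0 ≤ 1 - x ^ 2 + t ^ 2 - t * x := by
      have : t * x ≤ |t| := by
        have h2 := abs_mul t x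
        have h3 : |x| ≤ 1 := abs_le.2 ⟨by linarith [hx.1, neg_abs_le t, ht], (hreg x hx).2⟩
        calc t * x ≤ |t * x| := le_abs_self _
          _ = |t| * |x| := h2
          _ ≤ |t| * 1 := by gcongr
          _ = |t| := mul_one _
      linarith
    rw [neg_div]
    exact neg_nonpos.2 (div_nonneg (mul_nonneg (sub_nonneg.2 hx.1.le) h1) (by positivity))
  have hanti : AntitoneOn (fun y : ℝ => (1 - (y - t) * y) / √(1 - y ^ 2 + t ^ 2)) (Ioo t x₁) := by
    refine antitoneOn_of_deriv_nonpos (convex_Ioo t x₁)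
      (fun x hx => (hder x hx).continuousAt.continuousWithinAt) ?_ ?_
    · rw [interior_Ioo]
      exact fun x hx => (hder x hx).differentiableAt.differentiableWithinAt
    · rw [interior_Ioo]
      intro x hx
      rw [(hder x hx).deriv]
      exact hρ'le x hx
  have hderW : ∀ x ∈ Ioo t x₁, HasDerivWithinAt (fun y : ℝ => (1 - (y - t) * y) / √(1 - y ^ 2 + t ^ 2))
      (-((x - t) * (1 - x ^ 2 + t ^ 2 - t * x)) / ((1 - x ^ 2 + t ^ 2) * √(1 - x ^ 2 + t ^ 2)))
      (Ioo t x₁) x := fun x hx => (hder x hx).hasDerivWithinAt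
  -- the image lies in `[0, 1]`
  have himg : (fun y : ℝ => (1 - (y - t) * y) / √(1 - y ^ 2 + t ^ 2)) '' Ioo t x₁ ⊆ Icc 0 1 := by
    rintro _ ⟨x, hx, rfl⟩
    have hm4 := (hreg x hx).1
    have hxabs : |x| ≤ 1 := abs_le.2 ⟨by linarith [hx.1, neg_abs_le t, ht], (hreg x hx).2⟩
    refine ⟨div_nonneg ?_ (sqrt_nonneg _), (abs_le.1 (abs_stepCos_le_one hxabs t)).2⟩
    -- `1 - (x-t)x = m + (x-t)t ≥ 4|t| - (5/4)|t| ≥ 0`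
    have h1 : 1 - (x - t) * x = (1 - x ^ 2 + t ^ 2) + (x - t) * t := by ring
    have h2 : -(5 / 4 * |t|) ≤ (x - t) * t := by
      have hu : 0 ≤ x - t := sub_nonneg.2 hx.1.le
      have hu1 : x - t ≤ 5 / 4 := by linarith [(hreg x hx).2, neg_abs_le t]
      have : (x - t) * (-|t|) ≤ (x - t) * t := mul_le_mul_of_nonneg_left (neg_abs_le t) hu
      nlinarith
    nlinarith
  -- the test function on the image side
  have hgm : Measurable fun z : ℝ => (4 * z ^ 2 + 8 * |t|) * F z := by fun_prop
  have hgI : IntegrableOn (fun z : ℝ => (4 * z ^ 2 + 8 * |t|) * F z) (Icc 0 1) := by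
    refine IntegrableOn.of_bound measure_Icc_lt_top hgm.aestronglyMeasurable (4 + 8 * |t|)
      (ae_restrict_of_forall_mem measurableSet_Icc fun z hz => ?_)
    have hz1 : F z ≤ 1 := hF1 z (abs_le.2 ⟨by linarith [hz.1], hz.2⟩)
    have hz2 : z ^ 2 ≤ 1 := by nlinarith [hz.1, hz.2]
    rw [Real.norm_eq_abs, abs_of_nonneg (mul_nonneg (by positivity) (hF0 z))]
    calc (4 * z ^ 2 + 8 * |t|) * F z ≤ (4 * z ^ 2 + 8 * |t|) * 1 := by gcongr
      _ ≤ 4 + 8 * |t| := by nlinarith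
  have hgI' := hgI.mono_set himg
  have hJI := (integrableOn_image_iff_integrableOn_deriv_smul_of_antitoneOn measurableSet_Ioo hderW hanti
    (fun z : ℝ => (4 * z ^ 2 + 8 * |t|) * F z)).1 hgI'
  have hcv := integral_image_eq_integral_deriv_smul_of_antitoneOn measurableSet_Ioo hderW hanti
    (fun z : ℝ => (4 * z ^ 2 + 8 * |t|) * F z)
  -- integrability of `F`, `z² F` on `[0, 1]`
  have hFI : IntervalIntegrable F volume 0 1 := by
    refine (intervalIntegrable_const (c := (1:ℝ))).mono_fun' hF.aestronglyMeasurable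
      ((ae_restrict_iff' measurableSet_uIoc).2 (Eventually.of_forall fun z hz => ?_))
    rw [uIoc_of_le zero_le_one] at hz
    dsimp only
    rw [Real.norm_eq_abs, abs_of_nonneg (hF0 z)]
    exact hF1 z (abs_le.2 ⟨by linarith [hz.1], hz.2⟩)
  have hF2I : IntervalIntegrable (fun z : ℝ => z ^ 2 * F z) volume 0 1 := by
    refine (intervalIntegrable_const (c := (1:ℝ))).mono_fun' (by fun_prop) ((ae_restrict_iff' measurableSet_uIoc).2
      (Eventually.of_forall fun z hz => ?_))
    rw [uIoc_of_le zero_le_one] at hz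
    have hz2 : z ^ 2 ≤ 1 := by nlinarith [hz.1, hz.2]
    dsimp only
    rw [Real.norm_eq_abs, abs_of_nonneg (mul_nonneg (sq_nonneg z) (hF0 z))]
    calc z ^ 2 * F z ≤ 1 * 1 := mul_le_mul hz2 (hF1 z (abs_le.2 ⟨by linarith [hz.1], hz.2⟩)) (hF0 z) zero_le_one
      _ = 1 := one_mul _
  have hF01 : ∫ z in (0:ℝ)..1, F z ≤ 1 := by
    have h := intervalIntegral.integral_mono_on zero_le_one hFI intervalIntegrable_const
      (fun z (hz : z ∈ Icc (0:ℝ) 1) => hF1 z (abs_le.2 ⟨by linarith [hz.1], hz.2⟩))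
    simpa using h
  calc ∫ x in Ioo t x₁, 4 * (max (x - t) 0 * (√(1 - x ^ 2 + t ^ 2) * F ((1 - (x - t) * x) / √(1 - x ^ 2 + t ^ 2))))
      ≤ ∫ x in Ioo t x₁, -(-((x - t) * (1 - x ^ 2 + t ^ 2 - t * x)) / ((1 - x ^ 2 + t ^ 2) * √(1 - x ^ 2 + t ^ 2))) •
          ((4 * ((1 - (x - t) * x) / √(1 - x ^ 2 + t ^ 2)) ^ 2 + 8 * |t|) *
            F ((1 - (x - t) * x) / √(1 - x ^ 2 + t ^ 2))) := by
        refine integral_mono_of_nonneg (ae_restrict_of_forall_mem measurableSet_Ioo fun x hx => ?_) hJI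
          (ae_restrict_of_forall_mem measurableSet_Ioo fun x hx => stepCos_dom hF0 ht hx.1 (hreg x hx).2 (hreg x hx).1)
        exact mul_nonneg (by norm_num) (mul_nonneg (le_max_right _ _) (mul_nonneg (sqrt_nonneg _) (hF0 _)))
    _ = ∫ z in (fun y : ℝ => (1 - (y - t) * y) / √(1 - y ^ 2 + t ^ 2)) '' Ioo t x₁, (4 * z ^ 2 + 8 * |t|) * F z :=
        hcv.symm
    _ ≤ ∫ z in Icc 0 1, (4 * z ^ 2 + 8 * |t|) * F z :=
        setIntegral_mono_set hgI (ae_restrict_of_forall_mem measurableSet_Icc fun z _ =>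
          mul_nonneg (by positivity) (hF0 z)) (Eventually.of_forall himg)
    _ = ∫ z in (0:ℝ)..1, (4 * (z ^ 2 * F z) + 8 * |t| * F z) := by
        rw [intervalIntegral.integral_of_le zero_le_one, integral_Icc_eq_integral_Ioc]
        refine setIntegral_congr_fun measurableSet_Ioc fun z _ => ?_
        ring
    _ = (4 * ∫ z in (0:ℝ)..1, z ^ 2 * F z) + 8 * |t| * ∫ z in (0:ℝ)..1, F z := by
        rw [intervalIntegral.integral_add (hF2I.const_mul 4) (hFI.const_mul _),
          intervalIntegral.integral_const_mul, intervalIntegral.integral_const_mul]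
    _ ≤ (4 * ∫ z in (0:ℝ)..1, z ^ 2 * F z) + 8 * |t| := by
        nlinarith [mul_le_mul_of_nonneg_left hF01 (by positivity : (0:ℝ) ≤ 8 * |t|)]

/-! ### The Lorentz slice `t = 0` is exactly the law `4ρ² dρ` -/

/-- **The Lorentz slice is exactly `4ρ² dρ`** (FACT F in the cosine variable; NO hypothesis on `F`):
`4 ∫_{-1}^{1} x₊ √(1 - x²) F((1 - x·x)/√(1 - x²)) dx = 4 ∫₀¹ z² F(z) dz` (on `(0, 1)` the cosine is
`ρ = √(1 - x²)`, equal to the speed ratio; substitution `z = √(1 - x²)`, Mathlib's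
`integral_image_eq_integral_abs_deriv_smul`). In particular with `F = |P_ℓ|` the Lorentz one-step number is
`μ_ℓ = 4 ∫₀¹ z² |P_ℓ(z)| dz` of `…T12Legendre`. Registered helper. [folklore] -/
theorem t12_stepCos_lorentz_eq : ∀ F : ℝ → ℝ, 4 * ∫ x in (-1:ℝ)..1, max x 0 * (Real.sqrt (1 - x ^ 2) * F ((1 - x * x) / Real.sqrt (1 - x ^ 2))) = 4 * ∫ z in (0:ℝ)..1, z ^ 2 * F z := by
  intro F
  congr 1
  -- restrict to `(0, 1)`
  have h1 : ∫ x in (-1:ℝ)..1, max x 0 * (√(1 - x ^ 2) * F ((1 - x * x) / √(1 - x ^ 2))) =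
      ∫ x in Ioo (0:ℝ) 1, x * (√(1 - x ^ 2) * F ((1 - x * x) / √(1 - x ^ 2))) := by
    rw [intervalIntegral.integral_of_le (by norm_num : (-1:ℝ) ≤ 1), integral_Ioc_eq_integral_Ioo,
      setIntegral_eq_of_subset_of_forall_sdiff_eq_zero measurableSet_Ioo (Ioo_subset_Ioo (by norm_num : (-1:ℝ) ≤ 0) le_rfl)]
    · exact setIntegral_congr_fun measurableSet_Ioo fun x hx => by rw [max_eq_left hx.1.le]
    · intro x hx
      have hx0 : x ≤ 0 := by
        by_contra h
        exact hx.2 ⟨lt_of_not_ge h, hx.1.2⟩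
      rw [max_eq_right hx0, zero_mul]
  -- the substitution `z = √(1 - x²)` on `(0, 1)`
  have hderiv : ∀ x ∈ Ioo (0:ℝ) 1, HasDerivWithinAt (fun x : ℝ => √(1 - x ^ 2))
      ((0 - ↑(2:ℕ) * x ^ (2 - 1) * 1) / (2 * √(1 - x ^ 2))) (Ioo (0:ℝ) 1) x := by
    intro x hx
    have hpos : 0 < 1 - x ^ 2 := by nlinarith [hx.1, hx.2]
    exact (((hasDerivAt_const x (1:ℝ)).sub ((hasDerivAt_id x).pow 2)).sqrt hpos.ne').hasDerivWithinAt
  have hinj : InjOn (fun x : ℝ => √(1 - x ^ 2)) (Ioo (0:ℝ) 1) := by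
    intro x hx y hy hxy
    have hx' : 0 ≤ 1 - x ^ 2 := by nlinarith [hx.1, hx.2]
    have hy' : 0 ≤ 1 - y ^ 2 := by nlinarith [hy.1, hy.2]
    have h : 1 - x ^ 2 = 1 - y ^ 2 := by
      have := congrArg (fun r : ℝ => r ^ 2) hxy
      simpa only [sq_sqrt hx', sq_sqrt hy'] using this
    nlinarith [hx.1, hy.1]
  have himage : (fun x : ℝ => √(1 - x ^ 2)) '' Ioo (0:ℝ) 1 = Ioo 0 1 := by
    ext z
    constructor
    · rintro ⟨x, hx, rfl⟩
      have hpos : 0 < 1 - x ^ 2 := by nlinarith [hx.1, hx.2]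
      exact ⟨sqrt_pos.2 hpos, (sqrt_lt' one_pos).2 (by nlinarith [hx.1])⟩
    · intro hz
      have hpos : 0 < 1 - z ^ 2 := by nlinarith [hz.1, hz.2]
      refine ⟨√(1 - z ^ 2), ⟨sqrt_pos.2 hpos, (sqrt_lt' one_pos).2 (by nlinarith [hz.1])⟩, ?_⟩
      dsimp only
      rw [sq_sqrt hpos.le, sub_sub_cancel, sqrt_sq hz.1.le]
  have key := integral_image_eq_integral_abs_deriv_smul measurableSet_Ioo hderiv hinj (fun z : ℝ => z ^ 2 * F z)
  rw [himage] at key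
  rw [h1, intervalIntegral.integral_of_le (zero_le_one : (0:ℝ) ≤ 1), integral_Ioc_eq_integral_Ioo, key]
  refine setIntegral_congr_fun measurableSet_Ioo fun x hx => ?_
  have hpos : 0 < 1 - x ^ 2 := by nlinarith [hx.1, hx.2]
  have hs := sqrt_pos.2 hpos
  have hρ : (1 - x * x) / √(1 - x ^ 2) = √(1 - x ^ 2) := by
    rw [div_eq_iff hs.ne', ← sq, mul_self_sqrt hpos.le]
  rw [hρ, smul_eq_mul, sq_sqrt hpos.le]
  push_cast
  rw [pow_one, zero_sub, mul_one, abs_div, abs_neg, abs_of_nonneg (by linarith [hx.1] : (0:ℝ) ≤ 2 * x),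
    abs_of_pos (by positivity)]
  field_simp
  rw [sq_sqrt hpos.le]

end Summit.AtomisticToContinuum.HydrodynamicLimit.Theorems.ClampedCorrectorBirth
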